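import Literature.AnabelianGeometry.EtaleTheta.BiKummerRootTransportAt
import Literature.AnabelianGeometry.EtaleTheta.Discharge.Sec4RootTransportUniqueness
import Literature.AnabelianGeometry.EtaleTheta.Discharge.Sec4NonVacuityCoveringThm44
import Literature.AnabelianGeometry.EtaleTheta.Discharge.Sec5RootCompositionModel

/-!
# [EtTh] §4: the coherent root transport (`NthRoot.transportAt`, `exists_coherent_transport_at`) is NON-VACUOUS —
# all binders discharged SIMULTANEOUSLY at the Kummer-tower toy (`ToyCov`) for the identity self-equivalence (proof-only)

S. Mochizuki, *The étale theta function and its Frobenioid-theoretic manifestations*, Publ. RIMS **45** (2009)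
[cite: MochizukiEtTh2009, Prop 4.2 (iii)(iv) p.314–315 (PDF pp.88–89); Thm 4.4 p.320 (PDF p.94)].

abc-iut cell, layer L2, row R219 (seat abc-iut-f-121); CONSISTENCY WITNESS answering the RQ7 second reader abc-iut-f-183's INFO-2 on
p435513 («the joint satisfiability of the full binder list … is not exhibited at ONE setting»).  PROOF-ONLY over abc-iut-f-109 /
abc-iut-w4-d044 / abc-iut-L2-t3 lineage's Kummer-tower toy `ToyCov` (`Sec4NonVacuityCovering*.lean`: one base object `∗` with
`End(∗) = ℕ_{≥1}`, `Φ = ℚ_{≥0}`, `B = ℂ^× × ℚ_{≥0}^{gp}`, every object `μ_N`-saturated, Prop 4.2 (iii)(iv) HOLD) and this seat's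
`BiKummerRootTransportAt.lean` (p437236) / `Sec4RootTransportUniqueness.lean` (p435513/p436194).

WHAT IS PROVED.  At `ToyCov.biKummerSetting` with `Ψ := 𝟭` (abc-iut-L2-t3's `Thm44Hyp` inhabited as in `ToyCov.thm44_id`), `ψ := id`,
`pullFrac := B(Base −)`, the trivial fraction-pair `(id, id)` of `f = 1` on `A_⊙` and ANY of its `N`-th roots `R` (they exist:
`ToyCov.prop42_iii`), identity anchors and identity base isomorphism: EVERY binder of `NthRoot.exists_coherent_transport_at` is
DISCHARGED — T44-L03/L04/L09c/L10/L12/L15b at the identity (as in `ToyCov.thm44_id`), T44-L04b by `preservesBaseFrobeniusTypeData_of_inputs`,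
`Thm44_ii` by `thm44_ii_of_subnodes`, T44-L08/L15a/L15(⇒) by their closers, Prop 4.2 (iv) at the pair by `ToyCov.prop42_iv`, the anchor
laws by `rfl`/`simp`, the anchors are isometries (`PreFrobenioid.isIsometry_of_isIso`, `ToyCov` IS a Frobenioid), clause (e) at the
anchor from the root's own clause (e), functoriality of `B(Base −)` (`pullFracModel_comp_apply`) — so the conclusion
`∃ a b u, …` is INHABITED at a setting where roots exist (`coherent_transport_at_id`, `nonempty_nthRoot_one`).
HONEST LIMITS: consistency ≠ faithfulness; a toy (one base object, `Π^tp` trivial); the identity functor; nothing here bears on, or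
takes a side on, [IUTchIII] Cor. 3.12; typed ≠ proved.
-/

noncomputable section

namespace Literature.AnabelianGeometry.EtaleTheta

open CategoryTheory Opposite Literature.AlgebraicGeometry.Frobenioids

namespace ToyCov

/-- **Def 4.1 (i) inhabited at `ToyCov`**: the trivial fraction-pair `(id, id) : A_⊙ → A_⊙` for `f = 1` (`Div(id) = 0` has only the
trivial divisor in the sharp monoid `ℚ_{≥0}`). [cite: MochizukiEtTh2009, Def 4.1 (i) p.312 (PDF p.86)] -/
def fractionPairOne : biKummerSetting.FractionPair (A := Aodot) 1 Aodot where
  num := 𝟙 _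
  den := 𝟙 _
  isPreStep_num := ModelFrobenioid.isPreStep_id _
  isPreStep_den := ModelFrobenioid.isPreStep_id _
  base_eq := rfl
  frac_eq := ModelFrobenioid.frac_self _ _
  disjointSupports x hx _ := (divisorMonoid_isDivisorial Aodot.base).isSharp.eq_one_of_isUnit x (isUnit_of_dvd_one hx)

/-- `N`-th roots of the trivial pair EXIST at `ToyCov` (Prop 4.2 (iii) holds there). [cite: MochizukiEtTh2009, Prop 4.2 (iii) p.314 (PDF p.88)] -/
theorem nonempty_nthRoot_one (N : ℕ+) :
    Nonempty (biKummerSetting.NthRoot (A := Aodot) 1 fractionPairOne N (fun {_} φ x => temperedFrobenioid.pullFracModel φ x)) :=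
  prop42_iii 1 fractionPairOne N

/-- **abc-iut-L2-t3's `Thm44Hyp` for the IDENTITY self-equivalence of `ToyCov`** (as in `ToyCov.thm44_id`, exposed as a definite term).
[cite: MochizukiEtTh2009, Thm 4.4 p.320 (PDF p.94)] -/
def thm44HypId : BiKummerSetting.Thm44Hyp biKummerSetting biKummerSetting where
  isNonDilating₁ _ _ := trivial
  isNonDilating₂ _ _ := trivial
  baseShape₁ := ⟨(inferInstance : (𝟭 Base).Full), (inferInstance : (𝟭 Base).Faithful), pt,
    fun Y => ⟨fun _ => ⟨cover Y pt 1⟩, fun _ => ⟨Y, ⟨Iso.refl _⟩⟩⟩⟩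
  baseShape₂ := ⟨(inferInstance : (𝟭 Base).Full), (inferInstance : (𝟭 Base).Faithful), pt,
    fun Y => ⟨fun _ => ⟨cover Y pt 1⟩, fun _ => ⟨Y, ⟨Iso.refl _⟩⟩⟩⟩
  isOpen_Hodot₁ := by rw [show biKummerSetting.Hodot = ⊤ from MonoidHom.ker_one, Subgroup.coe_top]; exact isOpen_univ
  isOpen_Hodot₂ := by rw [show biKummerSetting.Hodot = ⊤ from MonoidHom.ker_one, Subgroup.coe_top]; exact isOpen_univ
  Ψ := CategoryTheory.Equivalence.refl
  Ψbs := CategoryTheory.Equivalence.refl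
  comm := biKummerSetting.base.rightUnitor ≪≫ biKummerSetting.base.leftUnitor.symm
  mapsAodot := ⟨Iso.refl _⟩

/-- `Ψ = 𝟭` acts as the identity on automorphism groups. [cite: MochizukiEtTh2009, Thm 4.4 p.320 (PDF p.94)] -/
theorem mapAut_id_eq (A : biKummerSetting.C) : thm44HypId.Ψ.functor.mapAut A = MonoidHom.id _ :=
  MonoidHom.ext fun _ => Aut.ext rfl

/-- T44-L03 at the identity. [cite: MochizukiEtTh2009, Thm 4.4 p.321 (PDF p.95)] -/
theorem thm44HypId_preservesFrobeniusStructure : thm44HypId.PreservesFrobeniusStructure :=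
  ⟨fun _ _ _ => rfl, fun _ _ _ h => h, fun _ _ _ h => h, fun _ _ _ h => h⟩

/-- T44-L09c at the identity (all `Aut_D` trivial). [cite: MochizukiEtTh2009, Thm 4.4 p.321 (PDF p.95)] -/
theorem thm44HypId_galoisCompatible : thm44HypId.GaloisCompatible := fun A _ =>
  ⟨trivial, Subgroup.ext fun σ => by
    rw [aut_eq_one _ σ]
    exact ⟨fun _ => one_mem _, fun _ => one_mem _⟩⟩

/-- T44-L10 at the identity (`ψ = id`). [cite: MochizukiEtTh2009, Thm 4.4 p.321 (PDF p.95)] -/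
theorem thm44HypId_biratCompatible : thm44HypId.BiratCompatible fun _ => MulEquiv.refl _ :=
  ⟨fun _ _ _ _ => rfl, fun _ _ _ _ _ _ _ _ => rfl, fun _ _ => rfl⟩

/-- T44-L12 at the identity. [cite: MochizukiEtTh2009, Thm 4.4 p.321 (PDF p.95)] -/
theorem thm44HypId_preservesDisjointSupports : thm44HypId.PreservesDisjointSupports := fun _ _ _ _ h => h

/-- T44-L15b at the identity. [cite: MochizukiEtTh2009, Thm 4.4 p.321 (PDF p.95)] -/
theorem thm44HypId_preservesNHSaturatedBsFld : thm44HypId.PreservesNHSaturatedBsFld := fun _ _ _ _ _ => Iff.rfl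

/-- T44-L04 at the identity (`Ψ(G) = G`, `Ψ α = α`). [cite: MochizukiEtTh2009, Thm 4.4 p.321 (PDF p.95)] -/
theorem thm44HypId_preservesBaseFrobeniusPairs : thm44HypId.PreservesBaseFrobeniusPairs := by
  intro A B G α₂ α₁ hG
  obtain ⟨P, Fr, h1, h2, h3, h4⟩ := hG
  exact ⟨P, Fr, h1, fun γ hγ => by
    obtain ⟨τ, hτ, rfl⟩ := Subgroup.mem_map.1 hγ
    exact h2 τ hτ, h3, h4⟩

/-- **NON-VACUITY of `NthRoot.exists_coherent_transport_at`**: at `ToyCov`, `Ψ = 𝟭`, the trivial pair of `f = 1` on `A_⊙`, ANY `N`-th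
root `R`, identity anchors and identity base isomorphism, every binder is discharged and the coherent transport datum `(a, b, u)` EXISTS.
[cite: MochizukiEtTh2009, Prop 4.2 (iv) p.315 (PDF p.89)] -/
theorem coherent_transport_at_id (N : ℕ+)
    (R : biKummerSetting.NthRoot (A := Aodot) 1 fractionPairOne N (fun {_} φ x => temperedFrobenioid.pullFracModel φ x)) :
    ∃ (a : thm44HypId.Ψ.functor.obj R.AN ≅ R.AN) (b : thm44HypId.Ψ.functor.obj R.BN ≅ R.BN) (u : Aut R.BN),
      u ∈ biKummerSetting.mu R.BN N ∧ u ∈ biKummerSetting.units R.BN ∧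
      a.inv ≫ thm44HypId.Ψ.functor.map R.α ≫ (Iso.refl _).hom = R.α ∧
      b.inv ≫ thm44HypId.Ψ.functor.map R.β ≫ (Iso.refl _).hom = R.β ∧
      a.inv ≫ thm44HypId.Ψ.functor.map R.pair.num ≫ b.hom = R.pair.num ∧
      a.inv ≫ thm44HypId.Ψ.functor.map R.pair.den ≫ b.hom = R.pair.den ≫ u.hom ∧
      biKummerSetting.base.mapIso a = (Iso.refl _).symm := by
  -- the Thm 4.4 inputs at the identity
  have hii : BiKummerSetting.Thm44_ii thm44HypId (fun _ => MulEquiv.refl _) :=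
    thm44HypId.thm44_ii_of_subnodes _ thm44HypId_preservesFrobeniusStructure thm44HypId_biratCompatible thm44HypId_preservesDisjointSupports
  have h4b : thm44HypId.PreservesBaseFrobeniusTypeData :=
    thm44HypId.preservesBaseFrobeniusTypeData_of_inputs thm44HypId_preservesFrobeniusStructure thm44HypId_preservesBaseFrobeniusPairs thm44HypId_galoisCompatible
  have h8 : thm44HypId.PreservesAmple := thm44HypId.preservesAmple_of thm44HypId_galoisCompatible
  have h15a : thm44HypId.PreservesFixedByHA (fun _ => MulEquiv.refl _) := thm44HypId.preservesFixedByHA_of _ thm44HypId_galoisCompatible thm44HypId_biratCompatible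
  have h15 : thm44HypId.PreservesSaturated (fun _ => MulEquiv.refl _) := thm44HypId.preservesSaturated_of _ thm44HypId_preservesFrobeniusStructure thm44HypId_preservesNHSaturatedBsFld
  -- Prop 4.2 (iv) at the pair (domain `A_⊙`)
  have hivP := BiKummerSetting.NthRoot.prop42_iv_at_of_prop42_iv (S := biKummerSetting)
    (fun {_ _} φ x => temperedFrobenioid.pullFracModel φ x) prop42_iv 1 fractionPairOne N
  -- functoriality of the transport
  have hpull : ∀ {A A' : biKummerSetting.C} (φ : A' ⟶ A) (f : biKummerSetting.biratUnits A),
      (MulEquiv.refl _) (temperedFrobenioid.pullFracModel φ f) =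
        temperedFrobenioid.pullFracModel (thm44HypId.Ψ.functor.map φ) ((MulEquiv.refl _) f) := fun _ _ => rfl
  have hpull₂ : ∀ {X Y Z : biKummerSetting.C} (φ : X ⟶ Y) (χ : Y ⟶ Z) (g : biKummerSetting.biratUnits Z),
      temperedFrobenioid.pullFracModel (φ ≫ χ) g = temperedFrobenioid.pullFracModel φ (temperedFrobenioid.pullFracModel χ g) :=
    fun φ χ g => temperedFrobenioid.pullFracModel_comp_apply φ χ g
  -- the identity anchors and their laws
  have hnum : (Iso.refl Aodot).inv ≫ thm44HypId.Ψ.functor.map fractionPairOne.num ≫ (Iso.refl Aodot).hom = fractionPairOne.num :=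
    by erw [Category.id_comp, Category.comp_id]; rfl
  have hden : (Iso.refl Aodot).inv ≫ thm44HypId.Ψ.functor.map fractionPairOne.den ≫ (Iso.refl Aodot).hom = fractionPairOne.den :=
    by erw [Category.id_comp, Category.comp_id]; rfl
  have hf : temperedFrobenioid.pullFracModel (Iso.refl Aodot).hom (1 : biKummerSetting.biratUnits Aodot) =
      (MulEquiv.refl _) (1 : biKummerSetting.biratUnits Aodot) := map_one _
  have heA : biKummerSetting.IsIsometry (Iso.refl Aodot).hom :=
    PreFrobenioid.isIsometry_of_isIso _ temperedFrobenioid_isFrobenioid.isPreFrobenioid _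
  have hAr : biKummerSetting.ArisesFromBaseFrobeniusPair (R.αData.G.map (thm44HypId.Ψ.functor.mapAut R.AN))
      (thm44HypId.Ψ.functor.map R.αData.α₂) (thm44HypId.Ψ.functor.map R.αData.α₁ ≫ (Iso.refl Aodot).hom) := by
    obtain ⟨P, Fr, h1, h2, h3, h4⟩ := R.αData.cond_e
    refine ⟨P, Fr, h1, fun γ hγ => ?_, ?_, h4⟩
    · obtain ⟨τ, hτ, rfl⟩ := Subgroup.mem_map.1 hγ
      exact h2 τ hτ
    · show P.hom (R.αData.α₁ ≫ 𝟙 _)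
      rw [Category.comp_id]
      exact h3
  have hebs : biKummerSetting.base.map R.α =
      (Iso.refl (biKummerSetting.base.obj R.AN)).hom ≫ biKummerSetting.base.map (thm44HypId.Ψ.functor.map R.α ≫ (Iso.refl Aodot).hom) :=
    by erw [Category.id_comp, Category.comp_id]; rfl
  exact BiKummerSetting.NthRoot.exists_coherent_transport_at thm44HypId (fun _ => MulEquiv.refl _)
    (fun {_ _} φ x => temperedFrobenioid.pullFracModel φ x) hpull hii thm44HypId_preservesFrobeniusStructure h4b h8 h15a h15 hivP R (Iso.refl Aodot)
    (Iso.refl Aodot) hnum hden hf heA heA hAr hpull₂ (Iso.refl _) hebs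

end ToyCov

end Literature.AnabelianGeometry.EtaleTheta

end
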